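import Summits.QuantumFields.YangMills.Theorems.BalabanUVNodesN22W1RelCentredTermDatum214
import Summits.QuantumFields.YangMills.Theorems.BalabanUVNodesN22W1RelCentredSectorOfWindowDilated

/-!
# BalabanUVNodes ∕ node N22 = NE9 — THE W1 OBJECT ON THE RELATIVE-DISC CENTRED ROAD (RE-TYPING M1′), MODULE J2: THE θ-FREE ENGINE AT THE (2.14) DATUM IN THE PRODUCER's
# WINDOW-DILATED MEMBER CURRENCY — R2's engine with its continued family `TFc`, its domain family `D` and its four coupling-side clauses REPLACED by per-base-point statements
# about MEMBERS `mF s₀ k′ Z t b old φ` in the dilation parameter `b ∈ ball 1 ρ_b` (dag-n10-c g6 `B13Term214WindowDilated` ∕ `B13Term214Centred` ∕ `B13Bound226Centred` shapes)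

Cell `pub-ymgap`, HUMAN RULING D-0062 (Track A), R134 ACCELERATION re-seat `pub-ymgap-dag-n22-c` (strategy s1), generation 7, file J2.  THEOREMS ONLY; imports R2
`…N22W1RelCentredTermDatum214` (§2 `n22At_u3OfRecord₁₂_ofRecordAdm_runTowers_toClusterTower_of_n18Below_relCentredTermDatum`) and J1 `…N22W1RelCentredSectorOfWindowDilated`
(the junction lemmas) BY NAME.  `--supports` the K3 item of record as a helper.

WHY.  R2's θ-free engine takes a continued family `TFc : GenTermFun` of the complex LAST coupling on a displayed domain family `D` with (S-last-T′) ∕ (S-226-T′) ∕ (S-vertex-T′)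
there and the real-window agreement with the datum's display `(𝔇 k′).TF`.  The producer of these clauses (node N10's lane) does not speak `u`: it continues the (2.14) term at a
base point `s₀ ∈ ]0,γ]` in the DILATION PARAMETER `b` ([I] (2.9)–(2.12) `B = g_kB′` read at complex ratio; lens T20) and proves, for `b ∈ ball 1 ρ_b`, holomorphy, the (2.26)
weight bound, the centred bound with the factor `s₀²`, holomorphy∕bound in the older terms at a fixed member, plus base-point freeness through the real ratio and the agreement of
the member `b = 1` with the keyed display.  THIS FILE is R2's engine RESTATED IN THAT CURRENCY: hypotheses on a member family `mF : ℝ → GenTermFun …`, conclusion `N22At` at the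
admissible reading of record on the generated run towers — inside, the continued family is `TFc k′ Z t u old φ := mF γ k′ Z t (γ∕u) old φ` on the SECTOR of the producer's
aperture `c` (J1 `read_of_basePointFree`, R3 `relSector_domainClauses`), and J1 turns each member statement into R2's clause (`Mv ↦ (1−c)⁻²·Mv`).  Neither `TFc` nor `D`
appears in the statement any more.

WHAT.  ★ `n22At_u3OfRecord₁₂_ofRecordAdm_runTowers_toClusterTower_of_n18Below_windowDilatedTermDatum`: R2 §2 with (hagree, hlast, hprop, hcen, domain clauses) ↦ (hMagree:
`mF s k′ Z t 1 old φ = (𝔇 k′).TF Z t s old φ` on the window; hMbase: `mF s₁ … ((s₁∕s₀)b) … = mF s₀ … b …`; hMlast ∕ hMprop ∕ hMcen: the member statements on `ball 1 ρ_b` for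
every base point; apertures `0 < cA < c < 1` with `c∕(1−c) < ρ_b`; the numerals at `Mv ↦ (1−c)⁻²·Mv`).

HONEST FRAMING.  Count-neutral re-currencying of R2's engine (J1 per slice, then R2 BY NAME); every member statement is a HYPOTHESIS (dag-n10-c's B13-currency theorems supply
their shapes for the window-dilated (2.14) family; the identification with the datum of record and the dilation covariance behind hMagree∕hMbase are def-W1∕N09's displayed
laws; the coupling-blind centre `V` and the large-field tail are the producer's — J1 `centred_of_twoStep`); (S-vertex-T′) NOT PRINTED; node N18 below is N18's; nothing of
Bałaban's asserted; N22 NOT discharged; one finite four-torus programme at fixed ε — NOT infinite volume, NOT OS on ℝ⁴, NOT a mass gap, NOT Clay.  0 `sorry`, 0 `def`,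
standard axioms.

References (TYPES only): [I] = [Balaban1987RG1] (0.23)–(0.25) pp. 256–257, §1 p. 263, (2.9)–(2.13) pp. 266–268; [II] = [Balaban1988RG2Cluster] (1.41) p. 11, (2.9)–(2.15)
pp. 14–16, (2.26) p. 17, Lemma 3 p. 20, (2.39)–(2.41) p. 21.
-/

noncomputable section

open scoped Matrix.Norms.L2Operator

namespace YMDAG.N22.W1

open Set Metric
open scoped BigOperators
open Literature.MathematicalPhysics.QuantumFieldTheory.Balaban1983to89
open Literature.MathematicalPhysics.QuantumFieldTheory.Balaban1983to89.T4Continuum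
open Literature.MathematicalPhysics.QuantumFieldTheory.Balaban1983to89.T4OutputRate
open Literature.MathematicalPhysics.QuantumFieldTheory.Balaban1983to89.TreeLengthTorus (TPt TDom tsys torusTreeLen torusTreeLen_nonneg)
open Literature.MathematicalPhysics.QuantumFieldTheory.Balaban1983to89.B12TreeDecay (K₀ K₀_pos)
open Literature.MathematicalPhysics.QuantumFieldTheory.Balaban1983to89.B13Lemma3TorusData (TBond)
open Literature.MathematicalPhysics.QuantumFieldTheory.Balaban1983to89.B13Lemma3TorusTerms (terms weight weight_nonneg)
open Literature.MathematicalPhysics.QuantumFieldTheory.Balaban1983to89.B13Lemma3TorusSocket (Lemma3Numerics)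
open Literature.MathematicalPhysics.QuantumFieldTheory.Balaban1983to89.Step (SFConsts)
open Literature.MathematicalPhysics.QuantumFieldTheory.Balaban1983to89.Node00
  (Stage12Params Stage13Params U3Objects₁₁ U3Letters₁₁ NE2Objects₁₁ NE3Letters₁₁ MatA ιSU prependCoupling)
open Literature.MathematicalPhysics.QuantumFieldTheory.Balaban1983to89.Node00.Sect2 (domSys domCount CPair ofBackgroundC spaceI domSites Setting Residual)
open Literature.MathematicalPhysics.QuantumFieldTheory.Balaban1983to89.Node00.W1
open YMDAG.UVSplit

variable {N : ℕ} [NeZero N]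

/-! ## §1 The θ-free engine at the (2.14) datum, window-dilated member currency -/

section Engine

variable {F : T4Family} {M : ℕ} [NeZero M] {L : ℕ} [NeZero L] (Gn : (k₁ : ℕ) → GenTower (F.P k₁) (MatA N) M)
  (sp : (k j : ℕ) → (domSys (F.P k) M j).Dom → Set (CPair (F.P k) (MatA N)))
  (gauge : (k : ℕ) → GaugeField (F.P k) 0 (Node00.SU N) → GaugeField (F.P k) 0 (Node00.SU N) → ℝ) (hg : ∀ k U U', 0 ≤ gauge k U U')
  (T₀ : (k : ℕ) → GaugeField (F.P (k + 1)) 0 (Node00.SU N) → GaugeField (F.P k) 0 (Node00.SU N))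
  (hT₀ : ∀ (k : ℕ) (U : GaugeField (F.P (k + 1)) 0 (Node00.SU N)),
    (∀ (j : ℕ) (Y : (domSys (F.P (k + 1)) M j).Dom), ofBackgroundC (ιSU N) U ∈ sp (k + 1) j Y) →
    ∀ (j : ℕ) (Y : (domSys (F.P k) M j).Dom), ofBackgroundC (ιSU N) (T₀ k U) ∈ sp k j Y)
  (li : LetterInputs) (θ : Stage12Params F N) (k : ℕ) (c : B13.Consts) (𝔇 : TermData214 c (F.P k) (MatA N) M L)
  (mF : ℝ → GenTermFun (F.P k) (MatA N) M L)
  (V : (k' : ℕ) → (domSys (F.P k) M (k' + 1)).Dom → TermLabel (F.P k) M k' L → OlderTerms (F.P k) (MatA N) M k' → CPair (F.P k) (MatA N) → ℂ)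
  {G : Type*} [GaugeGroup G] (Sg : Setting (MatA N) G) (Rz : Residual (F.P k) (MatA N))

open Classical in
/-- **`N22At` AT THE ADMISSIBLE READING OF RECORD ON GENERATED RUN TOWERS WHOSE GENERATOR AT THE RUN LENGTH IS THE (2.14) DATUM's, FROM WINDOW-DILATED MEMBER STATEMENTS**
(`Gn k = 𝔇.Gn`; the other run lengths' generators free).  R2's engine `…_relCentredTermDatum` in the producer's currency.  Displayed: the run-length-`k` table inside the space table
of record; socket numerals AT `a₅′` with the slack `2e^{a₅|Z|} ≤ e^{a₅′|Z|}`, S25's clauses, the renewal `… ≤ E₀`; the producer's aperture `c` and ball radius `ρ_b` with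
`c∕(1−c) < ρ_b`, the displayed-disc aperture `0 < cA < c < 1`; the smallness `(1−c)⁻²Mv·((1+cA)γ)² ≤ ½` and the letter relation `2(1−c)⁻²Mv·E₀·(1+cA)² ≤ li.A`; a MEMBER family
`mF : ℝ → GenTermFun` (base point `s₀`, dilation parameter in the coupling slot) with: BASE-POINT FREENESS `mF s₁ k′ Z t ((s₁∕s₀)b) old φ = mF s₀ k′ Z t b old φ` (real base points,
every complex `b`); the REAL-WINDOW AGREEMENT of the member `b = 1` with the datum's display, `mF s k′ Z t 1 old φ = (𝔇 k′).TF Z t s old φ`; below the run length and for every base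
point `s₀ ∈ ]0,γ]`: (S-last-T′)ʷ holomorphy in `b` + the (2.26) weight bound on `ball 1 ρ_b`; (S-226-T′)ʷ holomorphy + bound in the older terms at every fixed member `b ∈ ball 1 ρ_b`
and (P) for the coupling-blind centre `V`, along bounded holomorphic older-term curves on any open set; (S-vertex-T′)ʷ `‖mF s₀ k′ Z t b old φ − V k′ Z t old φ‖ ≤ Mv·s₀²·(weight·e^{a₅|Z|})`
on `ball 1 ρ_b`; node N18 below `k` at the same reading; the letter signs with `li.s = ½`, `li.μ = 1`, `0 < li.r ≤ min(cA,1)` ⟹ `N22At (u3OfRecord₁₂ θ (Dr.u3Objects θ.γ) k)`,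
`Dr := ReadingData.ofRecordAdm F M N (runTowers fun k₁ ↦ toClusterTower (Gn k₁)) sp gauge hg T₀ hT₀ li`.  Proof: R2 §2 at `TFc k′ Z t u old φ := mF γ k′ Z t (γ∕u) old φ`,
`D := fun _ ↦ {u | ∃ t ∈ ]0,γ], dist u t < c·t}` (R3 `relSector_domainClauses`), each clause by J1 (`read_of_basePointFree`, `differentiableOn_relSector_of_members`,
`norm_le_relSector_of_members`, `param_relSector_of_members`, `norm_sub_le_sq_relSector_of_members`, `eq_on_window_of_members`).
[cite: Balaban1988RG2Cluster, (1.41) p.11, (2.9)-(2.15) pp.14-16, (2.26) p.17, Lemma 3 p.20 and (2.39)-(2.41) p.21; Balaban1987RG1, §1 p.263, (2.9)-(2.13) pp.266-268] -/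
theorem n22At_u3OfRecord₁₂_ofRecordAdm_runTowers_toClusterTower_of_n18Below_windowDilatedTermDatum {cs : SFConsts} (hGn : Gn k = 𝔇.Gn)
    (hspk : ∀ (j : ℕ) (Y : (domSys (F.P k) M j).Dom), sp k j Y ⊆ spaceI Sg Rz M j (domSites (F.P k) M j Y) cs.α₀ cs.α₁)
    (hL : 8 ≤ c.L) (hLc : c.L = L) {a a₂ a₂' a₅ a₅' Aabs : ℝ} (hN : Lemma3Numerics c M ((c.L : ℝ) / 2) a a₂ a₂' a₅' Aabs)
    {E₀ r₁ Mv cA cP ρb : ℝ} (hA0 : 0 ≤ c.C3act * c.ε₁) (hr₁ : 0 ≤ r₁) (hκ : li.κ ≤ r₁)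
    (hrate : r₁ + 2 * (64 * Real.log 162) + 2 ≤ (1 - 8 * c.δ) * ((c.L : ℝ) / 2) * c.κ)
    (hsmall : c.C3act * c.ε₁ * Real.exp (5 * r₁ + 1) * K₀ 64 8 * 9 * 64 ≤ 1)
    (hrenew : Real.exp 1 * 9 * 64 * K₀ 64 8 ^ 2 * (c.C3act * c.ε₁) ≤ E₀)
    (h2w : ∀ (k' : ℕ) (Z : (domSys (F.P k) M (k' + 1)).Dom), 2 * Real.exp (a₅ * ((Z.1).card : ℝ)) ≤ Real.exp (a₅' * ((Z.1).card : ℝ)))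
    -- apertures: displayed discs `cA` < producer's sector `cP` < 1, producer's ball radius `ρb`
    (hc0 : 0 < cA) (hcAP : cA < cP) (hcP1 : cP < 1) (hρb : cP / (1 - cP) < ρb)
    (hMv : 0 < Mv) (hMvγ : (1 - cP)⁻¹ ^ 2 * Mv * ((1 + cA) * θ.γ) ^ 2 ≤ 1 / 2) (hAM : 2 * ((1 - cP)⁻¹ ^ 2 * Mv) * E₀ * (1 + cA) ^ 2 ≤ li.A)
    -- base-point freeness of the members through the REAL ratio
    (hMbase : ∀ (k' : ℕ) (Z : (domSys (F.P k) M (k' + 1)).Dom) (t : TermLabel (F.P k) M k' L) (old : OlderTerms (F.P k) (MatA N) M k') (φ : CPair (F.P k) (MatA N)),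
      ∀ s₀ ∈ Ioc (0 : ℝ) θ.γ, ∀ s₁ ∈ Ioc (0 : ℝ) θ.γ, ∀ b : ℂ, mF s₁ k' Z t ((((s₁ / s₀ : ℝ)) : ℂ) * b) old φ = mF s₀ k' Z t b old φ)
    -- the member `b = 1` of base point `s` IS the datum's display at coupling `s`
    (hMagree : ∀ (k' : ℕ) (Z : (domSys (F.P k) M (k' + 1)).Dom) (t : TermLabel (F.P k) M k' L) (s : ℝ), s ∈ Ioc (0 : ℝ) θ.γ →
      ∀ (old : OlderTerms (F.P k) (MatA N) M k') (φ : CPair (F.P k) (MatA N)), mF s k' Z t 1 old φ = (𝔇 k').TF Z t (s : ℂ) old φ)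
    -- (S-last-T′)ʷ: holomorphy in the dilation parameter + the (2.26) weight bound on the ball, every base point
    (hMlast : ∀ k' : ℕ, k' < k → ∀ old : OlderTerms (F.P k) (MatA N) M k',
      (∀ (j : Fin (k' + 1)) (Y : (domSys (F.P k) M j).Dom) (ψ : CPair (F.P k) (MatA N)), ψ ∈ spaceI Sg Rz M j (domSites (F.P k) M j Y) cs.α₀ cs.α₁ →
        ‖old j Y ψ‖ ≤ E₀ * Real.exp (-(li.κ * torusTreeLen Y.1))) →
      ∀ (X : (domSys (F.P k) M (k' + 1)).Dom) (φ : CPair (F.P k) (MatA N)), φ ∈ spaceI Sg Rz M (k' + 1) (domSites (F.P k) M (k' + 1) X) cs.α₀ cs.α₁ →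
        ∀ (Z : (domSys (F.P k) M (k' + 1)).Dom), Z.1 ⊆ X.1 → ∀ t ∈ terms L M Z, ∀ s₀ ∈ Ioc (0 : ℝ) θ.γ,
          DifferentiableOn ℂ (fun b => mF s₀ k' Z t b old φ) (ball (1 : ℂ) ρb) ∧
            ∀ b ∈ ball (1 : ℂ) ρb, ‖mF s₀ k' Z t b old φ‖ ≤ weight L M c Z a t * Real.exp (a₅ * ((Z.1).card : ℝ)))
    -- (S-226-T′)ʷ: holomorphy + bound in the OLDER terms at every fixed member
    (hMprop : ∀ k' : ℕ, k' < k → ∀ i : ℕ, i < k' → ∀ (O : Set ℂ), IsOpen O → ∀ s₀ ∈ Ioc (0 : ℝ) θ.γ, ∀ b ∈ ball (1 : ℂ) ρb,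
      ∀ cv : ℂ → OlderTerms (F.P k) (MatA N) M k',
      (∀ (j : Fin (k' + 1)) (Y : (domSys (F.P k) M j).Dom) (ψ : CPair (F.P k) (MatA N)), ψ ∈ spaceI Sg Rz M j (domSites (F.P k) M j Y) cs.α₀ cs.α₁ →
        DifferentiableOn ℂ (fun z => cv z j Y ψ) O ∧ ∀ z ∈ O, ‖cv z j Y ψ‖ ≤ E₀ * Real.exp (-(li.κ * torusTreeLen Y.1))) →
      ∀ (X : (domSys (F.P k) M (k' + 1)).Dom) (φ : CPair (F.P k) (MatA N)), φ ∈ spaceI Sg Rz M (k' + 1) (domSites (F.P k) M (k' + 1) X) cs.α₀ cs.α₁ →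
        ∀ (Z : (domSys (F.P k) M (k' + 1)).Dom), Z.1 ⊆ X.1 → ∀ t ∈ terms L M Z,
          DifferentiableOn ℂ (fun z => mF s₀ k' Z t b (cv z) φ) O ∧ ∀ z ∈ O, ‖mF s₀ k' Z t b (cv z) φ‖ ≤ weight L M c Z a t * Real.exp (a₅ * ((Z.1).card : ℝ)))
    -- (P): the coupling-blind centre along older-term curves (verbatim R2)
    (hpropV : ∀ k' : ℕ, k' < k → ∀ (O : Set ℂ), IsOpen O → ∀ cv : ℂ → OlderTerms (F.P k) (MatA N) M k',
      (∀ (j : Fin (k' + 1)) (Y : (domSys (F.P k) M j).Dom) (ψ : CPair (F.P k) (MatA N)), ψ ∈ spaceI Sg Rz M j (domSites (F.P k) M j Y) cs.α₀ cs.α₁ →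
        DifferentiableOn ℂ (fun z => cv z j Y ψ) O ∧ ∀ z ∈ O, ‖cv z j Y ψ‖ ≤ E₀ * Real.exp (-(li.κ * torusTreeLen Y.1))) →
      ∀ (X : (domSys (F.P k) M (k' + 1)).Dom) (φ : CPair (F.P k) (MatA N)), φ ∈ spaceI Sg Rz M (k' + 1) (domSites (F.P k) M (k' + 1) X) cs.α₀ cs.α₁ →
        ∀ (Z : (domSys (F.P k) M (k' + 1)).Dom), Z.1 ⊆ X.1 → ∀ t ∈ terms L M Z,
          DifferentiableOn ℂ (fun z => V k' Z t (cv z) φ) O ∧ ∀ z ∈ O, ‖V k' Z t (cv z) φ‖ ≤ weight L M c Z a t * Real.exp (a₅ * ((Z.1).card : ℝ)))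
    -- (S-vertex-T′)ʷ: the centred bound on the ball with the factor `s₀²`, every base point
    (hMcen : ∀ k' : ℕ, k' < k → ∀ old : OlderTerms (F.P k) (MatA N) M k',
      (∀ (j : Fin (k' + 1)) (Y : (domSys (F.P k) M j).Dom) (ψ : CPair (F.P k) (MatA N)), ψ ∈ spaceI Sg Rz M j (domSites (F.P k) M j Y) cs.α₀ cs.α₁ →
        ‖old j Y ψ‖ ≤ E₀ * Real.exp (-(li.κ * torusTreeLen Y.1))) →
      ∀ (X : (domSys (F.P k) M (k' + 1)).Dom) (φ : CPair (F.P k) (MatA N)), φ ∈ spaceI Sg Rz M (k' + 1) (domSites (F.P k) M (k' + 1) X) cs.α₀ cs.α₁ →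
        ∀ (Z : (domSys (F.P k) M (k' + 1)).Dom), Z.1 ⊆ X.1 → ∀ t ∈ terms L M Z, ∀ s₀ ∈ Ioc (0 : ℝ) θ.γ, ∀ b ∈ ball (1 : ℂ) ρb,
          ‖mF s₀ k' Z t b old φ - V k' Z t old φ‖ ≤ Mv * s₀ ^ 2 * (weight L M c Z a t * Real.exp (a₅ * ((Z.1).card : ℝ))))
    (h18 : ∀ k' : ℕ, k' < k →
      N18At (u3OfRecord₁₂ θ ((ReadingData.ofRecordAdm F M N (runTowers fun k₁ => toClusterTower (Gn k₁)) sp gauge hg T₀ hT₀ li).u3Objects θ.γ) k'))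
    (hC5 : 0 ≤ li.C₅) (hθ1 : li.θ₅ < 1) (hC₀' : 2 * li.C₅ / (1 - li.θ₅) ≤ li.C₀)
    (hC₀ : 0 < li.C₀) (hθ5 : 0 < li.θ₅) (hA : 0 < li.A) (hμ : li.μ = 1) (hr : 0 < li.r) (hrc : li.r ≤ min cA 1) (hγ : 0 < θ.γ) (hs : li.s = (2 : ℝ)⁻¹) :
    N22At (u3OfRecord₁₂ θ ((ReadingData.ofRecordAdm F M N (runTowers fun k₁ => toClusterTower (Gn k₁)) sp gauge hg T₀ hT₀ li).u3Objects θ.γ) k) := by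
  -- the canonical continued family read from the members at the base point `γ`, and the sector of the producer's aperture
  set TFc : GenTermFun (F.P k) (MatA N) M L := fun k' Z t u old φ => mF θ.γ k' Z t ((θ.γ : ℂ) / u) old φ with hTFc
  set D : ℕ → Set ℂ := fun _ => {z : ℂ | ∃ t ∈ Ioc (0 : ℝ) θ.γ, dist z (t : ℂ) < cP * t} with hD
  have hγw : θ.γ ∈ Ioc (0 : ℝ) θ.γ := ⟨hγ, le_rfl⟩
  have hcP0 : 0 < cP := hc0.trans hcAP
  obtain ⟨hDo, hDw, hDd⟩ := relSector_domainClauses (γ := θ.γ) hc0 hcAP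
  -- the reading identity on every relative ball, per slice
  have hread : ∀ (k' : ℕ) (Z : (domSys (F.P k) M (k' + 1)).Dom) (t : TermLabel (F.P k) M k' L) (old : OlderTerms (F.P k) (MatA N) M k')
      (φ : CPair (F.P k) (MatA N)), ∀ t₀ ∈ Ioc (0 : ℝ) θ.γ, ∀ u : ℂ, dist u (t₀ : ℂ) < cP * t₀ → TFc k' Z t u old φ = mF t₀ k' Z t ((t₀ : ℂ) / u) old φ :=
    fun k' Z t old φ t₀ ht₀ u _ => read_of_basePointFree (m := fun s b => mF s k' Z t b old φ) (hMbase k' Z t old φ) θ.γ hγw t₀ ht₀ u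
  refine n22At_u3OfRecord₁₂_ofRecordAdm_runTowers_toClusterTower_of_n18Below_relCentredTermDatum Gn sp gauge hg T₀ hT₀ li θ k c 𝔇 TFc V D Sg Rz hGn hspk hL hLc hN
    (Mv := (1 - cP)⁻¹ ^ 2 * Mv) (cA := cA) hA0 hr₁ hκ hrate hsmall hrenew h2w hDo hDw hDd hc0 (hcAP.trans hcP1) (by positivity) hMvγ hAM ?_ ?_ ?_ hpropV ?_ h18 hC5 hθ1 hC₀'
    hC₀ hθ5 hA hμ hr hrc hγ hs
  · -- hagree: the window point `s` reads the member `(s, 1)`, which is the display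
    intro k' Z t s hs old φ
    rw [eq_on_window_of_members (γ := θ.γ) (f := fun u => TFc k' Z t u old φ) (m := fun s b => mF s k' Z t b old φ) hcP0 (hread k' Z t old φ) s hs]
    exact hMagree k' Z t s hs old φ
  · -- hlast: holomorphy + weight bound on the sector from the member statements
    intro k' hk old hold X φ hφ Z hZ t ht
    exact ⟨differentiableOn_relSector_of_members hcP0.le hcP1 hρb (fun s₀ hs₀ => (hMlast k' hk old hold X φ hφ Z hZ t ht s₀ hs₀).1) (hread k' Z t old φ),
      norm_le_relSector_of_members hcP0.le hcP1 hρb (fun s₀ hs₀ => (hMlast k' hk old hold X φ hφ Z hZ t ht s₀ hs₀).2) (hread k' Z t old φ)⟩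
  · -- hprop: the older-terms direction at a fixed coupling of the sector, from the fixed member
    intro k' hk i hi O hO u hu cv hcv X φ hφ Z hZ t ht
    exact param_relSector_of_members (γ := θ.γ) hcP0.le hcP1 hρb (m := fun (p : OlderTerms (F.P k) (MatA N) M k') s b => mF s k' Z t b p φ)
      (f := fun p w => TFc k' Z t w p φ) (fun p => hread k' Z t p φ) (cv := cv)
      (fun s₀ hs₀ b hb => hMprop k' hk i hi O hO s₀ hs₀ b hb cv hcv X φ hφ Z hZ t ht) u hu
  · -- hcen: (S-vertex-T′) on the sector in R2's shape, `Mv ↦ (1−cP)⁻²·Mv`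
    intro k' hk old hold X φ hφ Z hZ t ht z hz
    exact norm_sub_le_sq_relSector_of_members hcP0 hcP1 hρb (fun s₀ hs₀ b hb => hMcen k' hk old hold X φ hφ Z hZ t ht s₀ hs₀ b hb) (hread k' Z t old φ) z hz

end Engine

/-! ## §2 The engine at one Stage-13 tuple -/

section Engine13

variable {F : T4Family} (θ : Stage13Params F N) {L : ℕ} [NeZero L] (Gn : (k₁ : ℕ) → GenTower (F.P k₁) (MatA N) θ.τ9.M)
  (sp : (k j : ℕ) → (domSys (F.P k) θ.τ9.M j).Dom → Set (CPair (F.P k) (MatA N)))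
  (gauge : (k : ℕ) → GaugeField (F.P k) 0 (Node00.SU N) → GaugeField (F.P k) 0 (Node00.SU N) → ℝ) (hg : ∀ k U U', 0 ≤ gauge k U U')
  (T₀ : (k : ℕ) → GaugeField (F.P (k + 1)) 0 (Node00.SU N) → GaugeField (F.P k) 0 (Node00.SU N))
  (hT₀ : ∀ (k : ℕ) (U : GaugeField (F.P (k + 1)) 0 (Node00.SU N)),
    (∀ (j : ℕ) (Y : (domSys (F.P (k + 1)) θ.τ9.M j).Dom), ofBackgroundC (ιSU N) U ∈ sp (k + 1) j Y) →
    ∀ (j : ℕ) (Y : (domSys (F.P k) θ.τ9.M j).Dom), ofBackgroundC (ιSU N) (T₀ k U) ∈ sp k j Y)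
  (li : LetterInputs) (k : ℕ) (c : B13.Consts) (𝔇 : TermData214 c (F.P k) (MatA N) θ.τ9.M L)
  (mF : ℝ → GenTermFun (F.P k) (MatA N) θ.τ9.M L)
  (V : (k' : ℕ) → (domSys (F.P k) θ.τ9.M (k' + 1)).Dom → TermLabel (F.P k) θ.τ9.M k' L → OlderTerms (F.P k) (MatA N) θ.τ9.M k' → CPair (F.P k) (MatA N) → ℂ)
  {G : Type*} [GaugeGroup G] (Sg : Setting (MatA N) G) (Rz : Residual (F.P k) (MatA N))

open Classical in
/-- **§1 AT ONE STAGE-13 TUPLE** (`NeZero θ.τ9.M` from the context; the Stage-13 bundle IS the Stage-12 bundle of `θ.toStage12Params`, `u3OfRecord₁₃_eq_u3OfRecord₁₂`) — the face the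
keyed binder storeys (Sep ∕ Co ∕ CoP editions) instantiate once per tuple, exactly as R2b §1 serves R2b §2 ∕ R2c ∕ their Co∕CoP twins.
[cite: Balaban1988RG2Cluster, (2.9)-(2.15) pp.14-16, (2.26) p.17, Lemma 3 p.20 and (2.39)-(2.41) p.21; Balaban1987RG1, §1 p.263, (2.9)-(2.13) pp.266-268] -/
theorem n22At_u3OfRecord₁₃_ofRecordAdm_runTowers_toClusterTower_of_n18Below_windowDilatedTermDatum [NeZero θ.τ9.M] {cs : SFConsts} (hGn : Gn k = 𝔇.Gn)
    (hspk : ∀ (j : ℕ) (Y : (domSys (F.P k) θ.τ9.M j).Dom), sp k j Y ⊆ spaceI Sg Rz θ.τ9.M j (domSites (F.P k) θ.τ9.M j Y) cs.α₀ cs.α₁)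
    (hL : 8 ≤ c.L) (hLc : c.L = L) {a a₂ a₂' a₅ a₅' Aabs : ℝ} (hN : Lemma3Numerics c θ.τ9.M ((c.L : ℝ) / 2) a a₂ a₂' a₅' Aabs)
    {E₀ r₁ Mv cA cP ρb : ℝ} (hA0 : 0 ≤ c.C3act * c.ε₁) (hr₁ : 0 ≤ r₁) (hκ : li.κ ≤ r₁)
    (hrate : r₁ + 2 * (64 * Real.log 162) + 2 ≤ (1 - 8 * c.δ) * ((c.L : ℝ) / 2) * c.κ)
    (hsmall : c.C3act * c.ε₁ * Real.exp (5 * r₁ + 1) * K₀ 64 8 * 9 * 64 ≤ 1)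
    (hrenew : Real.exp 1 * 9 * 64 * K₀ 64 8 ^ 2 * (c.C3act * c.ε₁) ≤ E₀)
    (h2w : ∀ (k' : ℕ) (Z : (domSys (F.P k) θ.τ9.M (k' + 1)).Dom), 2 * Real.exp (a₅ * ((Z.1).card : ℝ)) ≤ Real.exp (a₅' * ((Z.1).card : ℝ)))
    -- apertures: displayed discs `cA` < producer's sector `cP` < 1, producer's ball radius `ρb`
    (hc0 : 0 < cA) (hcAP : cA < cP) (hcP1 : cP < 1) (hρb : cP / (1 - cP) < ρb)
    (hMv : 0 < Mv) (hMvγ : (1 - cP)⁻¹ ^ 2 * Mv * ((1 + cA) * θ.γ) ^ 2 ≤ 1 / 2) (hAM : 2 * ((1 - cP)⁻¹ ^ 2 * Mv) * E₀ * (1 + cA) ^ 2 ≤ li.A)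
    -- base-point freeness of the members through the REAL ratio
    (hMbase : ∀ (k' : ℕ) (Z : (domSys (F.P k) θ.τ9.M (k' + 1)).Dom) (t : TermLabel (F.P k) θ.τ9.M k' L) (old : OlderTerms (F.P k) (MatA N) θ.τ9.M k') (φ : CPair (F.P k) (MatA N)),
      ∀ s₀ ∈ Ioc (0 : ℝ) θ.γ, ∀ s₁ ∈ Ioc (0 : ℝ) θ.γ, ∀ b : ℂ, mF s₁ k' Z t ((((s₁ / s₀ : ℝ)) : ℂ) * b) old φ = mF s₀ k' Z t b old φ)
    -- the member `b = 1` of base point `s` IS the datum's display at coupling `s`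
    (hMagree : ∀ (k' : ℕ) (Z : (domSys (F.P k) θ.τ9.M (k' + 1)).Dom) (t : TermLabel (F.P k) θ.τ9.M k' L) (s : ℝ), s ∈ Ioc (0 : ℝ) θ.γ →
      ∀ (old : OlderTerms (F.P k) (MatA N) θ.τ9.M k') (φ : CPair (F.P k) (MatA N)), mF s k' Z t 1 old φ = (𝔇 k').TF Z t (s : ℂ) old φ)
    -- (S-last-T′)ʷ: holomorphy in the dilation parameter + the (2.26) weight bound on the ball, every base point
    (hMlast : ∀ k' : ℕ, k' < k → ∀ old : OlderTerms (F.P k) (MatA N) θ.τ9.M k',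
      (∀ (j : Fin (k' + 1)) (Y : (domSys (F.P k) θ.τ9.M j).Dom) (ψ : CPair (F.P k) (MatA N)), ψ ∈ spaceI Sg Rz θ.τ9.M j (domSites (F.P k) θ.τ9.M j Y) cs.α₀ cs.α₁ →
        ‖old j Y ψ‖ ≤ E₀ * Real.exp (-(li.κ * torusTreeLen Y.1))) →
      ∀ (X : (domSys (F.P k) θ.τ9.M (k' + 1)).Dom) (φ : CPair (F.P k) (MatA N)), φ ∈ spaceI Sg Rz θ.τ9.M (k' + 1) (domSites (F.P k) θ.τ9.M (k' + 1) X) cs.α₀ cs.α₁ →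
        ∀ (Z : (domSys (F.P k) θ.τ9.M (k' + 1)).Dom), Z.1 ⊆ X.1 → ∀ t ∈ terms L θ.τ9.M Z, ∀ s₀ ∈ Ioc (0 : ℝ) θ.γ,
          DifferentiableOn ℂ (fun b => mF s₀ k' Z t b old φ) (ball (1 : ℂ) ρb) ∧
            ∀ b ∈ ball (1 : ℂ) ρb, ‖mF s₀ k' Z t b old φ‖ ≤ weight L θ.τ9.M c Z a t * Real.exp (a₅ * ((Z.1).card : ℝ)))
    -- (S-226-T′)ʷ: holomorphy + bound in the OLDER terms at every fixed member
    (hMprop : ∀ k' : ℕ, k' < k → ∀ i : ℕ, i < k' → ∀ (O : Set ℂ), IsOpen O → ∀ s₀ ∈ Ioc (0 : ℝ) θ.γ, ∀ b ∈ ball (1 : ℂ) ρb,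
      ∀ cv : ℂ → OlderTerms (F.P k) (MatA N) θ.τ9.M k',
      (∀ (j : Fin (k' + 1)) (Y : (domSys (F.P k) θ.τ9.M j).Dom) (ψ : CPair (F.P k) (MatA N)), ψ ∈ spaceI Sg Rz θ.τ9.M j (domSites (F.P k) θ.τ9.M j Y) cs.α₀ cs.α₁ →
        DifferentiableOn ℂ (fun z => cv z j Y ψ) O ∧ ∀ z ∈ O, ‖cv z j Y ψ‖ ≤ E₀ * Real.exp (-(li.κ * torusTreeLen Y.1))) →
      ∀ (X : (domSys (F.P k) θ.τ9.M (k' + 1)).Dom) (φ : CPair (F.P k) (MatA N)), φ ∈ spaceI Sg Rz θ.τ9.M (k' + 1) (domSites (F.P k) θ.τ9.M (k' + 1) X) cs.α₀ cs.α₁ →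
        ∀ (Z : (domSys (F.P k) θ.τ9.M (k' + 1)).Dom), Z.1 ⊆ X.1 → ∀ t ∈ terms L θ.τ9.M Z,
          DifferentiableOn ℂ (fun z => mF s₀ k' Z t b (cv z) φ) O ∧ ∀ z ∈ O, ‖mF s₀ k' Z t b (cv z) φ‖ ≤ weight L θ.τ9.M c Z a t * Real.exp (a₅ * ((Z.1).card : ℝ)))
    -- (P): the coupling-blind centre along older-term curves (verbatim R2)
    (hpropV : ∀ k' : ℕ, k' < k → ∀ (O : Set ℂ), IsOpen O → ∀ cv : ℂ → OlderTerms (F.P k) (MatA N) θ.τ9.M k',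
      (∀ (j : Fin (k' + 1)) (Y : (domSys (F.P k) θ.τ9.M j).Dom) (ψ : CPair (F.P k) (MatA N)), ψ ∈ spaceI Sg Rz θ.τ9.M j (domSites (F.P k) θ.τ9.M j Y) cs.α₀ cs.α₁ →
        DifferentiableOn ℂ (fun z => cv z j Y ψ) O ∧ ∀ z ∈ O, ‖cv z j Y ψ‖ ≤ E₀ * Real.exp (-(li.κ * torusTreeLen Y.1))) →
      ∀ (X : (domSys (F.P k) θ.τ9.M (k' + 1)).Dom) (φ : CPair (F.P k) (MatA N)), φ ∈ spaceI Sg Rz θ.τ9.M (k' + 1) (domSites (F.P k) θ.τ9.M (k' + 1) X) cs.α₀ cs.α₁ →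
        ∀ (Z : (domSys (F.P k) θ.τ9.M (k' + 1)).Dom), Z.1 ⊆ X.1 → ∀ t ∈ terms L θ.τ9.M Z,
          DifferentiableOn ℂ (fun z => V k' Z t (cv z) φ) O ∧ ∀ z ∈ O, ‖V k' Z t (cv z) φ‖ ≤ weight L θ.τ9.M c Z a t * Real.exp (a₅ * ((Z.1).card : ℝ)))
    -- (S-vertex-T′)ʷ: the centred bound on the ball with the factor `s₀²`, every base point
    (hMcen : ∀ k' : ℕ, k' < k → ∀ old : OlderTerms (F.P k) (MatA N) θ.τ9.M k',
      (∀ (j : Fin (k' + 1)) (Y : (domSys (F.P k) θ.τ9.M j).Dom) (ψ : CPair (F.P k) (MatA N)), ψ ∈ spaceI Sg Rz θ.τ9.M j (domSites (F.P k) θ.τ9.M j Y) cs.α₀ cs.α₁ →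
        ‖old j Y ψ‖ ≤ E₀ * Real.exp (-(li.κ * torusTreeLen Y.1))) →
      ∀ (X : (domSys (F.P k) θ.τ9.M (k' + 1)).Dom) (φ : CPair (F.P k) (MatA N)), φ ∈ spaceI Sg Rz θ.τ9.M (k' + 1) (domSites (F.P k) θ.τ9.M (k' + 1) X) cs.α₀ cs.α₁ →
        ∀ (Z : (domSys (F.P k) θ.τ9.M (k' + 1)).Dom), Z.1 ⊆ X.1 → ∀ t ∈ terms L θ.τ9.M Z, ∀ s₀ ∈ Ioc (0 : ℝ) θ.γ, ∀ b ∈ ball (1 : ℂ) ρb,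
          ‖mF s₀ k' Z t b old φ - V k' Z t old φ‖ ≤ Mv * s₀ ^ 2 * (weight L θ.τ9.M c Z a t * Real.exp (a₅ * ((Z.1).card : ℝ))))
    (h18 : ∀ k' : ℕ, k' < k →
      N18At (u3OfRecord₁₃ θ ((ReadingData.ofRecordAdm F θ.τ9.M N (runTowers fun k₁ => toClusterTower (Gn k₁)) sp gauge hg T₀ hT₀ li).u3Objects θ.γ) k'))
    (hC5 : 0 ≤ li.C₅) (hθ1 : li.θ₅ < 1) (hC₀' : 2 * li.C₅ / (1 - li.θ₅) ≤ li.C₀)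
    (hC₀ : 0 < li.C₀) (hθ5 : 0 < li.θ₅) (hA : 0 < li.A) (hμ : li.μ = 1) (hr : 0 < li.r) (hrc : li.r ≤ min cA 1) (hγ : 0 < θ.γ) (hs : li.s = (2 : ℝ)⁻¹) :
    N22At (u3OfRecord₁₃ θ ((ReadingData.ofRecordAdm F θ.τ9.M N (runTowers fun k₁ => toClusterTower (Gn k₁)) sp gauge hg T₀ hT₀ li).u3Objects θ.γ) k) := by
  rw [u3OfRecord₁₃_eq_u3OfRecord₁₂]
  exact n22At_u3OfRecord₁₂_ofRecordAdm_runTowers_toClusterTower_of_n18Below_windowDilatedTermDatum Gn sp gauge hg T₀ hT₀ li θ.toStage12Params k c 𝔇 mF V Sg Rz hGn hspk hL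
    hLc hN hA0 hr₁ hκ hrate hsmall hrenew h2w hc0 hcAP hcP1 hρb hMv hMvγ hAM hMbase hMagree hMlast hMprop hpropV hMcen
    (fun k' hk => by rw [← u3OfRecord₁₃_eq_u3OfRecord₁₂]; exact h18 k' hk) hC5 hθ1 hC₀' hC₀ hθ5 hA hμ hr hrc hγ hs

end Engine13

end YMDAG.N22.W1

end
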